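import Literature.Computability.QuantumComplexity.PathModelCupSliding
import HarnessLib

/-!
# Pairs of strands in the AJL path model: a capped pair braids trivially

Topic `Literature/Computability/QuantumComplexity`; sibling proof file of `PathModelCupSliding.lean`
(cup sliding `ρ(σ_i^ε) ρ(σ_{i+1}^ε) Φ_i = Φ_{i+1} Φ_i` and its mirror) and
`PathModelTemperleyLieb.lean` (the Temperley–Lieb relations). For three consecutive generators
`i, j = i+1, l = i+2` (strands `i+1, …, i+4`: a pair `P = (i+1, i+2)` next to a pair
`Q = (i+3, i+4)`) the braid that passes `P` through `Q` is, in time order, the word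
`σ_j σ_l σ_i σ_j` (or, equally, `σ_j σ_i σ_l σ_j`: the two middle letters commute), whose operator on
kets is `E = ρ(σ_j) ρ(σ_i) ρ(σ_l) ρ(σ_j)` (last letter leftmost). We prove, for either common
crossing sign (Aharonov–Jones–Landau 2009, Claims 2.2, 3.1; Kauffman 1987, §2, regular isotopy):

* `crossing_comm_of_le`: crossing matrices of far generators commute; hence the two spellings of
  the pair-pass operator agree (`pairPass_eq_pairPass'`);
* `pairPass'_mul_ajlPhiC`: `E Φ_i = Φ_l Φ_j Φ_i` — if `P` is capped (a state in the range of
  `Φ_i`), passing it through `Q` just carries the cap two strands to the right;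
* `pairPass_mul_ajlPhiC_add_two`: `E Φ_l = Φ_i Φ_j Φ_l` — if `Q` is capped, the cap moves two
  strands to the left;
* **`monodromy_mul_ajlPhiC`**, **`monodromy_mul_ajlPhiC_add_two`**: the full monodromy `E E`
  (pair `P` encircling pair `Q`, a pure braid) FIXES `Φ_i` and `Φ_l`: `E E Φ_i = Φ_i`,
  `E E Φ_l = Φ_l`. A pair of strands joined by a cap — trivial total charge — braids trivially
  around anything, and anything braids trivially around it (the loop slides off over the cap);
* `star_ajlCrossingMatrix`, `crossing_mul_crossing_not`: `ρ(σ_i^ε)⋆ = ρ(σ_i^{¬ε})` and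
  `ρ(σ_i^ε) ρ(σ_i^{¬ε}) = 1` (the inverse crossing), so that inverse excursions are covered by the
  same statements with the opposite sign.

These are the exact "control is `|0⟩` ⇒ nothing happens" half of the encoded controlled-phase
gadgets in the `PromiseBQP`-hardness of the Jones polynomial (the encoded `|0⟩` of a qubit block
is a capped pair, `PathModelEncodedQubits.lean`), cf. Aharonov–Arad 2011, §3.

No definitions and no new statements of results are introduced; everything is proved.

## References

* D. Aharonov, V. Jones, Z. Landau, Algorithmica 55 (2009); arXiv:quant-ph/0511096, §2.7
  Claim 2.2, §2.13, §3.1 Claim 3.1 [AharonovJonesLandau2009].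
* L. H. Kauffman, *State models and the Jones polynomial*, Topology 26 (1987), §2.
* D. Aharonov, I. Arad, New J. Phys. 13 (2011) 035019, §3 [AharonovArad2011].
-/

noncomputable section

open Matrix

namespace Literature.Computability.QuantumComplexity

variable {n k : ℕ} {i j l : Fin (n - 1)}

/-! ### Far commutation and inverse crossings -/

/-- **Crossing matrices of far generators commute** (`l ≥ i + 2`), for any signs.
[cite: AharonovJonesLandau2009, Claim 3.1] -/
theorem crossing_comm_of_le (hil : (i : ℕ) + 2 ≤ l) (ε ε' : Bool) :
    ajlCrossingMatrix k (i, ε) * ajlCrossingMatrix k (l, ε') =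
      ajlCrossingMatrix k (l, ε') * ajlCrossingMatrix k (i, ε) := by
  set c₁ := crossingWeight (ajlPoint k) ε true
  set c₂ := crossingWeight (ajlPoint k) ε false
  set c₁' := crossingWeight (ajlPoint k) ε' true
  set c₂' := crossingWeight (ajlPoint k) ε' false
  change (c₁ • ajlPhiC k n i + c₂ • (1 : Matrix _ _ ℂ)) * (c₁' • ajlPhiC k n l + c₂' • (1 : Matrix _ _ ℂ)) =
    (c₁' • ajlPhiC k n l + c₂' • (1 : Matrix _ _ ℂ)) * (c₁ • ajlPhiC k n i + c₂ • (1 : Matrix _ _ ℂ))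
  simp only [add_mul, mul_add, Matrix.smul_mul, Matrix.mul_smul, Matrix.one_mul, Matrix.mul_one,
    smul_smul, ajlPhiC_mul_comm_of_le hil, mul_comm c₁' c₁, mul_comm c₂' c₁, mul_comm c₁' c₂,
    mul_comm c₂' c₂]
  abel

/-- The capcup weight of the opposite crossing is the conjugate: `conj(A^{±1}) = A^{∓1}`.
[cite: AharonovJonesLandau2009, §2.13] -/
theorem conj_crossingWeight_ajlPoint (k : ℕ) (ε sm : Bool) :
    starRingEnd ℂ (crossingWeight (ajlPoint k) ε sm) = crossingWeight (ajlPoint k) (!ε) sm := by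
  have h1 : starRingEnd ℂ (ajlPoint k) = (ajlPoint k)⁻¹ := (ajlPoint_inv k).symm
  have h2 : starRingEnd ℂ (ajlPoint k)⁻¹ = ajlPoint k := by rw [map_inv₀, h1, inv_inv]
  cases ε <;> cases sm <;> simp [crossingWeight, h1, h2]

/-- **The adjoint of a crossing is the opposite crossing**: `ρ(σ_i^ε)⋆ = ρ(σ_i^{¬ε})`
(`|A| = 1`, `Φ_i` Hermitian). [cite: AharonovJonesLandau2009, Claim 2.2 and §2.13] -/
theorem star_ajlCrossingMatrix (k n : ℕ) (i : Fin (n - 1)) (ε : Bool) :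
    star (ajlCrossingMatrix k ((i, ε) : Fin (n - 1) × Bool)) = ajlCrossingMatrix k (i, !ε) := by
  change star (crossingWeight (ajlPoint k) ε true • ajlPhiC k n i +
      crossingWeight (ajlPoint k) ε false • (1 : Matrix _ _ ℂ)) =
    crossingWeight (ajlPoint k) (!ε) true • ajlPhiC k n i + crossingWeight (ajlPoint k) (!ε) false • 1
  rw [star_eq_conjTranspose, conjTranspose_add, conjTranspose_smul, conjTranspose_smul,
    ajlPhiC_conjTranspose, conjTranspose_one]
  change starRingEnd ℂ (crossingWeight (ajlPoint k) ε true) • ajlPhiC k n i +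
      starRingEnd ℂ (crossingWeight (ajlPoint k) ε false) • (1 : Matrix _ _ ℂ) = _
  rw [conj_crossingWeight_ajlPoint, conj_crossingWeight_ajlPoint]

/-- **A crossing followed by the opposite crossing is the identity** (Reidemeister II on two
strands): `ρ(σ_i^ε) ρ(σ_i^{¬ε}) = 1`. [cite: AharonovJonesLandau2009, Claim 2.2] -/
theorem crossing_mul_crossing_not (k n : ℕ) (i : Fin (n - 1)) (ε : Bool) :
    ajlCrossingMatrix k (i, ε) * ajlCrossingMatrix k (i, !ε) =
      (1 : Matrix (Cryptography.QReg n) (Cryptography.QReg n) ℂ) := by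
  rw [← star_ajlCrossingMatrix]
  exact Matrix.mem_unitaryGroup_iff.1 (ajlCrossingMatrix_mem_unitaryGroup k n (i, ε))

/-- `ρ(σ_i^{¬ε}) ρ(σ_i^ε) = 1`. [cite: AharonovJonesLandau2009, Claim 2.2] -/
theorem crossing_not_mul_crossing (k n : ℕ) (i : Fin (n - 1)) (ε : Bool) :
    ajlCrossingMatrix k (i, !ε) * ajlCrossingMatrix k (i, ε) =
      (1 : Matrix (Cryptography.QReg n) (Cryptography.QReg n) ℂ) := by
  have := crossing_mul_crossing_not k n i (!ε)
  rwa [Bool.not_not] at this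

/-! ### Right-associated action forms -/

/-- `ρ(σ_i^{¬ε}) (ρ(σ_i^ε) X) = X`. [cite: AharonovJonesLandau2009, Claim 2.2] -/
theorem crossing_not_mul_crossing_mul (k : ℕ) (i : Fin (n - 1)) (ε : Bool)
    (X : Matrix (Cryptography.QReg n) (Cryptography.QReg n) ℂ) :
    ajlCrossingMatrix k (i, !ε) * (ajlCrossingMatrix k (i, ε) * X) = X := by
  rw [← Matrix.mul_assoc, crossing_not_mul_crossing, Matrix.one_mul]

/-- Far commutation, action form: `ρ(σ_i) (ρ(σ_l) X) = ρ(σ_l) (ρ(σ_i) X)` for `l ≥ i + 2`.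
[cite: AharonovJonesLandau2009, Claim 3.1] -/
theorem crossing_mul_crossing_mul_comm_of_le (hil : (i : ℕ) + 2 ≤ l) (ε ε' : Bool)
    (X : Matrix (Cryptography.QReg n) (Cryptography.QReg n) ℂ) :
    ajlCrossingMatrix k (i, ε) * (ajlCrossingMatrix k (l, ε') * X) =
      ajlCrossingMatrix k (l, ε') * (ajlCrossingMatrix k (i, ε) * X) := by
  rw [← Matrix.mul_assoc, crossing_comm_of_le hil, Matrix.mul_assoc]

section Assoc

variable (hij : (j : ℕ) = i + 1)
include hij

/-- Cup sliding to the right, action form: `ρ(σ_i) (ρ(σ_j) (Φ_i X)) = Φ_j (Φ_i X)`.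
[cite: AharonovJonesLandau2009, Claim 2.2 and Claim 3.1] -/
theorem slide_right_mul (ε : Bool) (X : Matrix (Cryptography.QReg n) (Cryptography.QReg n) ℂ) :
    ajlCrossingMatrix k (i, ε) * (ajlCrossingMatrix k (j, ε) * (ajlPhiC k n i * X)) =
      ajlPhiC k n j * (ajlPhiC k n i * X) := by
  rw [← Matrix.mul_assoc, ← Matrix.mul_assoc, crossing_mul_crossing_succ_mul_ajlPhiC hij, Matrix.mul_assoc]

/-- Cup sliding to the right, action form without tail: `ρ(σ_i) (ρ(σ_j) Φ_i) = Φ_j Φ_i`.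
[cite: AharonovJonesLandau2009, Claim 2.2 and Claim 3.1] -/
theorem slide_right (ε : Bool) :
    ajlCrossingMatrix k (i, ε) * (ajlCrossingMatrix k (j, ε) * ajlPhiC k n i) = ajlPhiC k n j * ajlPhiC k n i := by
  rw [← Matrix.mul_assoc, crossing_mul_crossing_succ_mul_ajlPhiC hij]

/-- Cup sliding to the left, action form: `ρ(σ_j) (ρ(σ_i) (Φ_j X)) = Φ_i (Φ_j X)`.
[cite: AharonovJonesLandau2009, Claim 2.2 and Claim 3.1] -/
theorem slide_left_mul (ε : Bool) (X : Matrix (Cryptography.QReg n) (Cryptography.QReg n) ℂ) :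
    ajlCrossingMatrix k (j, ε) * (ajlCrossingMatrix k (i, ε) * (ajlPhiC k n j * X)) =
      ajlPhiC k n i * (ajlPhiC k n j * X) := by
  rw [← Matrix.mul_assoc, ← Matrix.mul_assoc, crossing_succ_mul_crossing_mul_ajlPhiC hij, Matrix.mul_assoc]

/-- Cup sliding to the left, action form without tail: `ρ(σ_j) (ρ(σ_i) Φ_j) = Φ_i Φ_j`.
[cite: AharonovJonesLandau2009, Claim 2.2 and Claim 3.1] -/
theorem slide_left (ε : Bool) :
    ajlCrossingMatrix k (j, ε) * (ajlCrossingMatrix k (i, ε) * ajlPhiC k n j) = ajlPhiC k n i * ajlPhiC k n j := by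
  rw [← Matrix.mul_assoc, crossing_succ_mul_crossing_mul_ajlPhiC hij]

/-- `Φ_i (Φ_j (Φ_i X)) = Φ_i X`. [cite: AharonovJonesLandau2009, Claim 3.1] -/
theorem ajlPhiC_mul_succ_mul_self_mul (X : Matrix (Cryptography.QReg n) (Cryptography.QReg n) ℂ) :
    ajlPhiC k n i * (ajlPhiC k n j * (ajlPhiC k n i * X)) = ajlPhiC k n i * X := by
  rw [← Matrix.mul_assoc, ← Matrix.mul_assoc, ajlPhiC_mul_succ_mul hij]

/-- `Φ_i (Φ_j Φ_i) = Φ_i`. [cite: AharonovJonesLandau2009, Claim 3.1] -/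
theorem ajlPhiC_mul_succ_mul_self : ajlPhiC k n i * (ajlPhiC k n j * ajlPhiC k n i) = ajlPhiC k n i := by
  rw [← Matrix.mul_assoc, ajlPhiC_mul_succ_mul hij]

/-- `Φ_j (Φ_i (Φ_j X)) = Φ_j X`. [cite: AharonovJonesLandau2009, Claim 3.1] -/
theorem ajlPhiC_succ_mul_mul_self_mul (X : Matrix (Cryptography.QReg n) (Cryptography.QReg n) ℂ) :
    ajlPhiC k n j * (ajlPhiC k n i * (ajlPhiC k n j * X)) = ajlPhiC k n j * X := by
  rw [← Matrix.mul_assoc, ← Matrix.mul_assoc, ajlPhiC_succ_mul_mul_succ hij]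

/-- `Φ_j (Φ_i Φ_j) = Φ_j`. [cite: AharonovJonesLandau2009, Claim 3.1] -/
theorem ajlPhiC_succ_mul_mul_self : ajlPhiC k n j * (ajlPhiC k n i * ajlPhiC k n j) = ajlPhiC k n j := by
  rw [← Matrix.mul_assoc, ajlPhiC_succ_mul_mul_succ hij]

end Assoc

/-! ### The pair-pass operator and its two spellings -/

section PairPass

variable (hij : (j : ℕ) = i + 1) (hjl : (l : ℕ) = j + 1)
include hij hjl

/-- The two spellings of the pair-pass operator agree:
`ρ(σ_j) ρ(σ_i) ρ(σ_l) ρ(σ_j) = ρ(σ_j) ρ(σ_l) ρ(σ_i) ρ(σ_j)` (the far letters `σ_i, σ_l` commute).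
[cite: AharonovJonesLandau2009, Claim 3.1] -/
theorem pairPass_eq_pairPass' (ε : Bool) :
    ajlCrossingMatrix k (j, ε) * ajlCrossingMatrix k (i, ε) * ajlCrossingMatrix k (l, ε) *
        ajlCrossingMatrix k (j, ε) =
      ajlCrossingMatrix k (j, ε) * ajlCrossingMatrix k (l, ε) * ajlCrossingMatrix k (i, ε) *
        ajlCrossingMatrix k (j, ε) := by
  rw [Matrix.mul_assoc (ajlCrossingMatrix k (j, ε)) (ajlCrossingMatrix k (i, ε)),
    crossing_comm_of_le (by omega) ε ε, ← Matrix.mul_assoc]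

/-- **Passing a capped pair to the right**: `ρ(σ_j) ρ(σ_l) ρ(σ_i) ρ(σ_j) Φ_i = Φ_l Φ_j Φ_i`
(time order `σ_j, σ_i, σ_l, σ_j`: strand `i+3` hops left over the cap, then strand `i+4` does; the
cap at `i+1, i+2` ends at `i+3, i+4`). [cite: AharonovJonesLandau2009, Claim 2.2 and Claim 3.1] -/
theorem pairPass'_mul_ajlPhiC (ε : Bool) :
    ajlCrossingMatrix k (j, ε) * ajlCrossingMatrix k (l, ε) * ajlCrossingMatrix k (i, ε) *
        ajlCrossingMatrix k (j, ε) * ajlPhiC k n i =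
      ajlPhiC k n l * ajlPhiC k n j * ajlPhiC k n i := by
  simp only [Matrix.mul_assoc]
  rw [slide_right hij, slide_right_mul hjl]

/-- **Passing through a capped pair to the left**: `ρ(σ_j) ρ(σ_i) ρ(σ_l) ρ(σ_j) Φ_l = Φ_i Φ_j Φ_l`
(time order `σ_j, σ_l, σ_i, σ_j`: strand `i+2` hops right over the cap at `i+3, i+4`, then strand
`i+1` does; the cap ends at `i+1, i+2`). [cite: AharonovJonesLandau2009, Claim 2.2 and Claim 3.1] -/
theorem pairPass_mul_ajlPhiC_add_two (ε : Bool) :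
    ajlCrossingMatrix k (j, ε) * ajlCrossingMatrix k (i, ε) * ajlCrossingMatrix k (l, ε) *
        ajlCrossingMatrix k (j, ε) * ajlPhiC k n l =
      ajlPhiC k n i * ajlPhiC k n j * ajlPhiC k n l := by
  simp only [Matrix.mul_assoc]
  rw [slide_left hjl, slide_left_mul hij]

/-- **A capped pair encircling a pair acts trivially**: the monodromy `E E`,
`E = ρ(σ_j) ρ(σ_i) ρ(σ_l) ρ(σ_j)`, satisfies `E E Φ_i = Φ_i` — on every state in which the pair
`i+1, i+2` is capped the pure braid taking it around the pair `i+3, i+4` and back is the identity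
(`Φ_i Φ_j Φ_l Φ_j Φ_i = Φ_i (Φ_j Φ_l Φ_j) Φ_i = Φ_i Φ_j Φ_i = Φ_i`).
[cite: AharonovJonesLandau2009, Claim 2.2 and Claim 3.1] -/
theorem monodromy_mul_ajlPhiC (ε : Bool) :
    ajlCrossingMatrix k (j, ε) * ajlCrossingMatrix k (i, ε) * ajlCrossingMatrix k (l, ε) *
        ajlCrossingMatrix k (j, ε) *
      (ajlCrossingMatrix k (j, ε) * ajlCrossingMatrix k (i, ε) * ajlCrossingMatrix k (l, ε) *
        ajlCrossingMatrix k (j, ε)) * ajlPhiC k n i = ajlPhiC k n i := by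
  have hil : (i : ℕ) + 2 ≤ l := by omega
  simp only [Matrix.mul_assoc]
  -- inner pass in the primed spelling, acting on the cap at `i`
  rw [crossing_mul_crossing_mul_comm_of_le hil ε ε (ajlCrossingMatrix k (j, ε) * ajlPhiC k n i),
    slide_right hij, slide_right_mul hjl,
    -- outer pass on the cap now at `l`
    slide_left_mul hjl ε (ajlPhiC k n j * ajlPhiC k n i),
    slide_left_mul hij ε (ajlPhiC k n l * (ajlPhiC k n j * ajlPhiC k n i)),
    -- `Φ_i Φ_j Φ_l Φ_j Φ_i = Φ_i`
    ajlPhiC_mul_succ_mul_self_mul hjl, ajlPhiC_mul_succ_mul_self hij]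

/-- **A pair encircling a capped pair acts trivially**: `E E Φ_l = Φ_l` — on every state in which
the pair `i+3, i+4` is capped, the monodromy of the pair `i+1, i+2` around it is the identity
(the loop slides off over the cap). [cite: AharonovJonesLandau2009, Claim 2.2 and Claim 3.1] -/
theorem monodromy_mul_ajlPhiC_add_two (ε : Bool) :
    ajlCrossingMatrix k (j, ε) * ajlCrossingMatrix k (i, ε) * ajlCrossingMatrix k (l, ε) *
        ajlCrossingMatrix k (j, ε) *
      (ajlCrossingMatrix k (j, ε) * ajlCrossingMatrix k (i, ε) * ajlCrossingMatrix k (l, ε) *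
        ajlCrossingMatrix k (j, ε)) * ajlPhiC k n l = ajlPhiC k n l := by
  have hil : (i : ℕ) + 2 ≤ l := by omega
  simp only [Matrix.mul_assoc]
  rw [slide_left hjl, slide_left_mul hij,
    crossing_mul_crossing_mul_comm_of_le hil ε ε
      (ajlCrossingMatrix k (j, ε) * (ajlPhiC k n i * (ajlPhiC k n j * ajlPhiC k n l))),
    slide_right_mul hij ε (ajlPhiC k n j * ajlPhiC k n l),
    slide_right_mul hjl ε (ajlPhiC k n i * (ajlPhiC k n j * ajlPhiC k n l)),
    ajlPhiC_succ_mul_mul_self_mul hij, ajlPhiC_succ_mul_mul_self hjl]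

/-- Monodromy, vector form: a state with the pair `i+1, i+2` capped is fixed.
[cite: AharonovJonesLandau2009, Claim 2.2 and Claim 3.1] -/
theorem monodromy_mulVec_of_cap (ε : Bool) (u : Cryptography.QReg n → ℂ) :
    (ajlCrossingMatrix k (j, ε) * ajlCrossingMatrix k (i, ε) * ajlCrossingMatrix k (l, ε) *
        ajlCrossingMatrix k (j, ε) *
      (ajlCrossingMatrix k (j, ε) * ajlCrossingMatrix k (i, ε) * ajlCrossingMatrix k (l, ε) *
        ajlCrossingMatrix k (j, ε))) *ᵥ (ajlPhiC k n i *ᵥ u) = ajlPhiC k n i *ᵥ u := by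
  rw [mulVec_mulVec, monodromy_mul_ajlPhiC hij hjl]

/-- Monodromy, vector form: a state with the pair `i+3, i+4` capped is fixed.
[cite: AharonovJonesLandau2009, Claim 2.2 and Claim 3.1] -/
theorem monodromy_mulVec_of_cap_add_two (ε : Bool) (u : Cryptography.QReg n → ℂ) :
    (ajlCrossingMatrix k (j, ε) * ajlCrossingMatrix k (i, ε) * ajlCrossingMatrix k (l, ε) *
        ajlCrossingMatrix k (j, ε) *
      (ajlCrossingMatrix k (j, ε) * ajlCrossingMatrix k (i, ε) * ajlCrossingMatrix k (l, ε) *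
        ajlCrossingMatrix k (j, ε))) *ᵥ (ajlPhiC k n l *ᵥ u) = ajlPhiC k n l *ᵥ u := by
  rw [mulVec_mulVec, monodromy_mul_ajlPhiC_add_two hij hjl]

/-- **The inverse pair-pass undoes the pair-pass**: with the opposite sign and the mirrored
spelling, `E'(¬ε) E(ε) = 1` (`E'(¬ε) = ρ(σ_j^{¬ε}) ρ(σ_l^{¬ε}) ρ(σ_i^{¬ε}) ρ(σ_j^{¬ε})` is the
operator of the time-reversed inverse word). [cite: AharonovJonesLandau2009, Claim 2.2] -/
theorem pairPass'_not_mul_pairPass (ε : Bool) :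
    ajlCrossingMatrix k (j, !ε) * ajlCrossingMatrix k (l, !ε) * ajlCrossingMatrix k (i, !ε) *
        ajlCrossingMatrix k (j, !ε) *
      (ajlCrossingMatrix k (j, ε) * ajlCrossingMatrix k (i, ε) * ajlCrossingMatrix k (l, ε) *
        ajlCrossingMatrix k (j, ε)) = 1 := by
  have hil : (i : ℕ) + 2 ≤ l := by omega
  simp only [Matrix.mul_assoc]
  rw [crossing_not_mul_crossing_mul, crossing_not_mul_crossing_mul,
    crossing_not_mul_crossing_mul, crossing_not_mul_crossing]

end PairPass

end Literature.Computability.QuantumComplexity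

end
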